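import Mathlib
import HarnessLib
import Literature.Computability.AlgebraicComplexity.PatternExpressions
import Literature.Combinatorics.SimpleGraph.TreeDecomposition
import Summits.ValiantsHypothesis.ValiantsHypothesis.Theorems.MonotoneRestorationOrbitRestorationQPHomSpan
import Summits.ValiantsHypothesis.ValiantsHypothesis.Theorems.MonotoneRestorationOrbitRestorationQPHomPolyClose
import Summits.ValiantsHypothesis.ValiantsHypothesis.Theorems.MonotoneRestorationOrbitRestorationQPCloseAlgebra
import Summits.ValiantsHypothesis.ValiantsHypothesis.Theorems.MonotoneRestorationMonotoneRestorationQPSparseRegime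

/-!
# Matrix-symmetric polynomials are closed narrow pattern expressions: the polylog-degree floor of K1ᵉ /
# of the repaired `stub_orbitToNarrowExpression` (VP-free, circuit-free)

Route MonotoneRestoration; derived node `NonnegRestorationQP` (stmt-16191: `stub_orbitCompression` =
`OrbitCompressionQP`, line `expression_compression`) and crux `OrbitRestorationQP` (stmt-18293: K1ᵉ of
`Theorems/…NarrowExpressions.lean`).  From the spanning theorem `HomSpan.mem_span_homPoly_of_matrixSymmetric`
(every matrix-symmetric `p` is a combination of `hom_{F,n}` with `≤ deg p` vertices a side), K2
(`OrbitRestorationQPHomPolyClose.exists_close_eq_homPoly`: `hom_{F,n}` of a pattern of treewidth `≤ w` is a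
closed expression with `w + 1` labels a side) and the algebra of closed expressions
(`exists_close_eq_add/smul`):

* `exists_close_eq_of_matrixSymmetric` — every matrix-symmetric polynomial `p` on the `n × n` matrix,
  `n ≥ 1`, is the closed polynomial of a labelled pattern expression with `2·deg p + 1` row labels and
  `2·deg p + 1` column labels;
* `narrowExpression_of_polylogDegree` — hence every matrix-symmetric family of POLYLOGARITHMIC degree
  satisfies, with NO circuit or `VP` hypothesis, the conclusion of `stub_orbitToNarrowExpression` of line
  `Cruxes/OrbitCompressionQP/Lines/expression_compression.lean` verbatim
  (`∃ c, ∀ n ≥ 1, ∃ k l e, n^{k+l} ≤ 2^{(log₂ n + c)^c} ∧ e.close n = f n`) — the floor of that stub's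
  REPAIRED form (matrix symmetry added; the registered form is refuted in
  `Theorems/…OrbitToNarrowExpressionFalse.lean`), and the floor of K1ᵉ.

Honest label: VP-free floor; the stubs above the floor stay open; VP ≠ VNP not moved.
[cite: DwivediPagoSeppelt2026, §8] [cite: DawarPagoSeppelt2025, §5]
-/

noncomputable section

open MvPolynomial

-- `Summit.ValiantsHypothesis.ValiantsHypothesis.…` is the tree's single-conjunct layout (Sub = Summit).
set_option linter.dupNamespace false

namespace Summit.ValiantsHypothesis.ValiantsHypothesis.Theorems

namespace HomSpan

open Literature.Computability.AlgebraicComplexity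

variable {n : ℕ}

/-- **Every matrix-symmetric polynomial is a closed narrow pattern expression**: `2·deg p + 1` row labels
and as many column labels suffice (`n ≥ 1`). [folklore] -/
theorem exists_close_eq_of_matrixSymmetric (hn : 1 ≤ n) (p : MvPolynomial (Fin n × Fin n) ℂ)
    (hp : ∀ σ τ : Equiv.Perm (Fin n),
      rename (fun ij : Fin n × Fin n => (σ ij.1, τ ij.2)) p = p) :
    ∃ e : PatternExpr ℂ (2 * p.totalDegree + 1) (2 * p.totalDegree + 1), e.close n = p := by
  have hmem := mem_span_homPoly_of_matrixSymmetric p hp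
  refine Submodule.span_induction (p := fun q _ =>
    ∃ e : PatternExpr ℂ (2 * p.totalDegree + 1) (2 * p.totalDegree + 1), e.close n = q)
    ?_ ?_ ?_ ?_ hmem
  · rintro q ⟨a, b, E, ha, hb, -, rfl⟩
    refine OrbitRestorationQPHomPolyClose.exists_close_eq_homPoly E (w := 2 * p.totalDegree) ?_ hn
      (by omega) (by omega)
    refine (Literature.Combinatorics.SimpleGraph.treewidth_le_card_sub_one _).trans ?_
    simp only [Fintype.card_sum, Fintype.card_fin]
    omega
  · exact ⟨PatternExpr.const 0, by simp [PatternExpr.close]⟩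
  · rintro q₁ q₂ - - ⟨e₁, h₁⟩ ⟨e₂, h₂⟩
    obtain ⟨e, he⟩ := OrbitRestorationQPHomPolyClose.exists_close_eq_add n e₁ e₂
    exact ⟨e, by rw [he, h₁, h₂]⟩
  · rintro a q - ⟨e₁, h₁⟩
    obtain ⟨e, he⟩ := OrbitRestorationQPHomPolyClose.exists_close_eq_smul n a e₁
    exact ⟨e, by rw [he, h₁]⟩

/-- Label bookkeeping: `n^{2(2d+1)} ≤ 2^{(log₂ n + c₁)^{c₁}}` when `d ≤ (log₂ n + c)^c`. [folklore] -/
theorem pow_labels_le (c : ℕ) : ∃ c₁ : ℕ, ∀ n d : ℕ, d ≤ (Nat.log 2 n + c) ^ c →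
    n ^ ((2 * d + 1) + (2 * d + 1)) ≤ 2 ^ ((Nat.log 2 n + c₁) ^ c₁) := by
  obtain ⟨c₁, hc₁⟩ := SparseRegime.polylogDegree_sparse_le (c + 2)
  refine ⟨c₁, fun n d hd => ?_⟩
  have h2 : 2 * d + 1 ≤ (Nat.log 2 n + (c + 2)) ^ (c + 2) := by
    have h1 : 1 ≤ (Nat.log 2 n + c) ^ c := by
      rcases Nat.eq_zero_or_pos c with rfl | hc
      · simp
      · exact Nat.one_le_pow _ _ (by omega)
    calc 2 * d + 1 ≤ 4 * (Nat.log 2 n + c) ^ c := by omega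
      _ ≤ (Nat.log 2 n + (c + 2)) ^ 2 * (Nat.log 2 n + (c + 2)) ^ c := by
          refine Nat.mul_le_mul ?_ (Nat.pow_le_pow_left (by omega) c)
          nlinarith [Nat.zero_le (Nat.log 2 n + c)]
      _ = (Nat.log 2 n + (c + 2)) ^ (c + 2) := by rw [← pow_add, add_comm 2 c]
  calc n ^ ((2 * d + 1) + (2 * d + 1)) = (n * n) ^ (2 * d + 1) := by rw [mul_pow, ← pow_add]
    _ ≤ (n * n + 1) ^ (2 * d + 1) := Nat.pow_le_pow_left (Nat.le_succ _) _
    _ ≤ 2 ^ ((Nat.log 2 n + c₁) ^ c₁) := (hc₁ n _ h2).1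

/-- **The polylog-degree floor of the (repaired) narrow-expression stub, VP-free and circuit-free.**  Every
matrix-symmetric family of total degree `≤ (log₂ n + c)^c` satisfies — verbatim — the conclusion of
`stub_orbitToNarrowExpression` of line `expression_compression` of `OrbitCompressionQP`
(= `stub_orbitCompression` of `NonnegRestorationQP`): for one constant and every `n ≥ 1` it is the closed
polynomial of a labelled pattern expression with `k + l` labels, `n^{k+l} ≤ 2^{(log₂ n + c')^{c'}}`.
[folklore] -/
theorem narrowExpression_of_polylogDegree (f : (n : ℕ) → MvPolynomial (Fin n × Fin n) ℂ)
    (hsymm : ∀ (n : ℕ) (σ τ : Equiv.Perm (Fin n)),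
      rename (fun p : Fin n × Fin n => (σ p.1, τ p.2)) (f n) = f n)
    (hdeg : ∃ c : ℕ, ∀ n : ℕ, (f n).totalDegree ≤ (Nat.log 2 n + c) ^ c) :
    ∃ c : ℕ, ∀ n : ℕ, 1 ≤ n → ∃ (k l : ℕ) (e : PatternExpr ℂ k l),
      n ^ (k + l) ≤ 2 ^ ((Nat.log 2 n + c) ^ c) ∧ e.close n = f n := by
  obtain ⟨c, hc⟩ := hdeg
  obtain ⟨c₁, hc₁⟩ := pow_labels_le c
  refine ⟨c₁, fun n hn => ?_⟩
  obtain ⟨e, he⟩ := exists_close_eq_of_matrixSymmetric hn (f n) (hsymm n)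
  exact ⟨_, _, e, hc₁ n _ (hc n), he⟩

end HomSpan

end Summit.ValiantsHypothesis.ValiantsHypothesis.Theorems

end
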